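/-
Copyright: cell `pub-ymgap` (HUMAN RULING D-0062), Track A, DAG node N20; seat `pub-ymgap-dag-n20-d` (generation 4), module 1.
-/
import Literature.MathematicalPhysics.QuantumFieldTheory.Balaban1983to89.BlockAveragingSectionQsstar
import Literature.MathematicalPhysics.QuantumFieldTheory.Balaban1983to89.BlockAveragingEMLProp2
import Literature.MathematicalPhysics.QuantumFieldTheory.Balaban1983to89.Node00.LargeFieldReprOfRecord
import Summits.QuantumFields.YangMills.Theorems.BalabanUVNodesN20LCSAvgByValue
import HarnessLib

/-!
# YM-DAG node N20 (= NE7b): THE SEMANTICS OF NODE 00's SMALL-FIELD FUNCTIONS `χ_k(□)` OF RECORD — the (2.16) local variational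
# problem of record is SOLVABLE ONLY AT LOCALLY REGULAR DATA ([Balaban1988Convergent] p. 267 l. 5–7 + [Balaban1985Averaging] Prop. 2),
# `χ_k(□) = 1` BY JUNK off the solvable set, and module 4's smallness-on-support hypothesis `hsupp` FROM SOLVABILITY ON THE SUPPORT

Track A of `YM-PLAN.md` (cell `pub-ymgap`, HUMAN RULING D-0062), node **N20** = spine estimate NE7b (`T4WeightBudget.RelWeightBound`, NOT PRINTED,
NOT PROVED).  Seat `pub-ymgap-dag-n20-d` (director-ym R134), generation 4, module 1; kernel theorems only (0 `def`, 0 `sorry`, standard axioms);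
COUNT-NEUTRAL (`--supports stmt-QuantumFields-19908 --as helper`).  It answers generation 3's located residual (b) (HANDOFF §3): *«the semantics of
def-R's `chiSeqOfRecord` (which plaquettes it pins small, at which threshold) — module 4's `hsupp` is a HYPOTHESIS»*.

THE OBJECTS (all NODE 00's ∕ r11's ∕ r12's, BY NAME; nothing re-declared).  At step `k` of the `K`-th torus, def-R's `chiSeqOfRecord F N ν M g K k s`
([Balaban1988Convergent] (2.17)–(2.18) p. 257) is r11's `chi218` = `chi217` over the `LM₂R_k`-cubes `□ ⊂ Ω_k(s)`: a PRODUCT of the factors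
`χ_k(□)(V) = chiSmall {p ⊂ □^∼} (ε_kη_k²) (U_{k,□}(V))`, where the LOCAL BACKGROUND (2.16) `U_{k,□}(V) = ukBox bg M₁ □^{∼4} k V =
bg.U (𝐁_k(□^{∼4})) (M˙(Q_k^{s*}V))` is the value of the (2.12) SOLUTION MAP OF RECORD `bg = bgOfRecord (avOfRecord F N K) {U | PlaqSmall (εreg·η_k²) U}`
— TOTALISED by the chair's (c2) idiom (`Node00.UminOfRecord`): a minimiser of the Wilson action in the regularity class under the constraints
«`M_𝐁(U) = M˙(Q_k^{s*}V)` on `𝐁_k(□^{∼4})`» CHOSEN when one exists, and THE UNIT CONFIGURATION otherwise.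

WHAT THIS FILE PROVES.
* §1 `iter_avOfRecord_qsstarGIter0`: the SECTION PROPERTY `M^k(Q_k^{s*}V) = V` for the averaging of record (generation 4's Literature brick
  `BlockAveragingSectionQsstar.iter_blockAvg_qsstarGIter0` read at `Node00.avOfRecord = blockAvg expMeanLogSU`; the exp[mean log] of a constant
  family `1` is `1`).
* §2 **THE (2.16) PROBLEM OF RECORD IS SOLVABLE ONLY AT LOCALLY REGULAR DATA.**  On the solvable set of the problem on `□^{∼4}` (hypothesis
  `hsolv : ∃ U₀, IsMinimizer …` — the shape of [Balaban1985PropagatorsII] Thm 1, NOT asserted): the local background lies in the regularity class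
  (`plaqSmall_ukBox_of_solvable`: `|U_{k,□}(V)(∂p) − 1| < εreg·η_k²` on the WHOLE fine torus) and satisfies the constraint, whose TOP-SCALE member
  (`B14.Eq213DetSet.Bj_top`: `Γ_k = pts k (maxDomT M₁ □^{∼4} k)`) reads, by §1, **`M^k(U_{k,□}(V)) = V` on every `k`-bond meeting
  `pts k (maxDomT M₁ □^{∼4} k)`** (`iter_ukBox_eq_of_mem_bondsOf`) — print's *«By the definition of these configurations, and the constraints on V_k,
  we have M^{k+1}(U_{k+1}) = V_{k+1} = M^{k+1}(U_{k+1,□′}) on □′~»* ([Balaban1988Convergent] p. 267 l. 5–7) at the objects of record; hence, by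
  [Balaban1985Averaging] Prop. 2 (52) ⇒ (54) for the averaging of record (`BlockAveragingEMLProp2.plaqSmall_iter_blockAvg_eml_eta`, `k`-uniform),
  **`|V(∂p′) − 1| < 2εreg` for every plaquette `p′` of `T^{(k)}` cornered in `pts k (maxDomT M₁ □^{∼4} k)`** (`dist1_plaqHol_lt_of_solvable`) — the
  LOCAL twin, for the (2.16) backgrounds inside `χ_k`, of n21-c's `N21AveragedDatumRegularity.plaqSmall_datum_of_ukExists` (the GLOBAL (0.21)
  background `Node00.Uk`).
* §3 **THE SEMANTICS OF `χ_k(□)`.**  OFF the solvable set `U_{k,□}(V) = 1` (`ukBox_eq_one_of_not_solvable`) and THEREFORE `χ_k(□)(V) = 1` for every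
  positive threshold (`chiSmall_ukBox_eq_one_of_not_solvable`): the factor is `1` BY JUNK and carries NO smallness of `V` — the located reading of
  the typing convention; ON the solvable set `χ_k(□)(V) = 1` says literally that the minimiser is `ε_kη_k²`-small on `{p ⊂ □^∼}`
  (`plaqSmallOn_ukBox_of_chi217_ne_zero`, `…_of_chiSeqOfRecord_ne_zero`, `…_of_chiOfRecord_ne_zero`: a non-zero product of `0/1` factors has
  every factor `1`), while the smallness OF `V` comes from solvability alone (§2).  So a support condition «`χ_k(s)(V) ≠ 0 ⇒ V small`» holds
  exactly RELATIVE TO SOLVABILITY.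
* §4 **MODULE 4's `hsupp` FROM SOLVABILITY ON THE SUPPORT** (`lcs_piece_tstepOfRecord_expPlaqSum_bySolvability`): generation 3's by-value «LCS-(k+1)»
  `N20LCSAvgByValue.lcs_piece_tstepOfRecord_expPlaqSum_byValue` with its smallness-on-support hypothesis DISCHARGED, at `δ = 2εreg`, from: a cover
  of the boxes `boxRegion (emb p′₋) ((d+3)L+2)`, `p′ ∈ Q`, by top-scale constraint regions `pts k (maxDomT M₁ (boxes i) k)` of finitely or
  infinitely many enlarged cubes `boxes i`, and SOLVABILITY of the (2.16) problems on the `boxes i` wherever the pinned fine density is non-zero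
  (the (H-U)-shaped hypothesis the K0′ lineage carries; in print: [Balaban1985PropagatorsII] Thm 1 inside the inductive small-field domains).

HONEST FRAMING.  Count-neutral kernel bookkeeping plus two printed facts read at the objects of record (the p. 267 constraint identity, via the
lattice identity `M(Q^{s*}V) = V` for the smeared averaging; Prop. 2 of [Balaban1985Averaging], already in the tree).  Solvability is a
HYPOTHESIS everywhere ([Balaban1985PropagatorsII] Thm 1 is NOT asserted); nothing of Bałaban's is asserted; NE7b NOT PRINTED ∕ NOT PROVED; the
(α)-instance 0∕1; N20 NOT discharged; typed 28∕28, count untouched; one finite torus at fixed `ε` — NOT ℝ⁴, NOT infinite volume, NOT OS, NOT a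
mass gap, NOT Clay.

References: T. Bałaban, CMP 119 (1988) 243–285 [Balaban1988Convergent] ((2.12)–(2.13) p.256–257, (2.16)–(2.18) p.257, p.267 l.5–7); CMP 98 (1985)
17–51 [Balaban1985Averaging] (Prop. 2 (52)–(54) p.26); CMP 109 (1987) 249–301 [Balaban1987RG1] ((0.4) p.253); T. Bałaban, J. Imbrie, A. Jaffe, CMP 97
(1985) 299–329 [BalabanImbrieJaffe1985] ((4.5.3) p.312, (2.19) p.305); CMP 122 (1989) 355–392 [Balaban1989LargeFieldII] (p.383 l.21–28).
-/

noncomputable section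

open scoped BigOperators Matrix.Norms.L2Operator

namespace Summit.QuantumFields.YangMills.BalabanUVNodes.N20ChiSemantics

open MeasureTheory
open Literature.MathematicalPhysics.QuantumFieldTheory.Balaban1983to89
open Literature.MathematicalPhysics.QuantumFieldTheory.Balaban1983to89.T4Continuum (T4Family)
open Literature.MathematicalPhysics.QuantumFieldTheory.Balaban1983to89.Node00
open B15DeterminingSets B14.Eq213DetSet B14.Eq216Concrete B14.Eq218Concrete B15Eq112TorusCover
open BlockAveraging (blockAvg blockAvg_avg)
open ExpMeanLog (expMeanLogSU deltaSU)
open BlockAveragingSectionQsstar (iter_blockAvg_qsstarGIter0)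
open Literature.MathematicalPhysics.QuantumFieldTheory.BalabanImbrieJaffe1984to88.BIJ85Eq453GaugeField (qsstarGIter0)
open Summit.QuantumFields.YangMills.BalabanUVNodes.N20LCSAvgDominationRegion (boxRegion)
open Summit.QuantumFields.YangMills.BalabanUVNodes.N20LCSAvgByValue (lcs_piece_tstepOfRecord_expPlaqSum_byValue)

variable {F : T4Family} {N : ℕ} [NeZero N]

/-! ## §1 The section property `M^k(Q_k^{s*}V) = V` at the averaging of record -/

/-- **`M^k(Q_k^{s*}V) = V` AT NODE 00's AVERAGING OF RECORD** (`k ≤ m + K` on the `K`-th torus): the `k`-fold average of record of the pull-back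
`Q_k^{s*}V` is `V` — `BlockAveragingSectionQsstar.iter_blockAvg_qsstarGIter0` at `avOfRecord F N K = fun _ => blockAvg expMeanLogSU`, the printed
exp[mean log] of a constant family `1` being `1`. [cite: Balaban1988Convergent, (2.16) p.257; BalabanImbrieJaffe1985, (2.19) p.305] -/
theorem iter_avOfRecord_qsstarGIter0 {K k : ℕ} (hk : k ≤ (F.P K).m + (F.P K).K) (V : GaugeField (F.P K) k (SU N)) :
    Averaging.iter (avOfRecord F N K) k (qsstarGIter0 k V) = V := by
  haveI : Nonempty (Fin N) := ⟨⟨0, Nat.pos_of_ne_zero (NeZero.ne N)⟩⟩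
  have hE : ∀ n : ℕ, (expMeanLogSU (n := Fin N)).E (fun _ : Fin (n + 1) => (1 : SU N)) = 1 := fun n => by
    show ExpMeanLog.ESU (fun _ : Fin (n + 1) => (1 : SU N)) = 1
    have h : ∀ i : Fin (n + 1), ‖(((fun _ => (1 : SU N)) i : SU N) : Matrix (Fin N) (Fin N) ℂ) - 1‖ < deltaSU (Fin N) := fun i => by
      simp only [OneMemClass.coe_one, sub_self, norm_zero]
      exact ExpMeanLog.deltaSU_pos
    apply Subtype.ext
    rw [ExpMeanLog.coe_ESU_of_small h, ExpMeanLog.eml_eq_exp]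
    simp
  exact iter_blockAvg_qsstarGIter0 (P := F.P K) expMeanLogSU hE k hk V

/-- The same in the (2.11) multi-scale dress `M˙(·) = avgFamily`: the scale-`k` member of `M˙(Q_k^{s*}V)` is `V`. [cite: Balaban1988Convergent, (2.11) p.256] -/
theorem avgFamily_avOfRecord_qsstarGIter0 {K k : ℕ} (hk : k ≤ (F.P K).m + (F.P K).K) (V : GaugeField (F.P K) k (SU N)) :
    avgFamily (avOfRecord F N K) (qsstarGIter0 k V) k = V :=
  iter_avOfRecord_qsstarGIter0 hk V

/-! ## §2 The (2.16) local problem of record is solvable only at locally regular data -/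

section Solvable

variable {K k : ℕ} {ε : ℝ} {M₁ : ℕ} {box4 : Set (Site (F.P K) 0)} {V : GaugeField (F.P K) k (SU N)}

/-- ON THE SOLVABLE SET THE LOCAL BACKGROUND OF RECORD IS A MINIMISER of (2.12) for the determining set `𝐁_k(□^{∼4})` and the data `M˙(Q_k^{s*}V)`
(`B14.Eq216Concrete.isMinimizer_ukBox` for the datum of record, whose domain IS the solvable set). [cite: Balaban1988Convergent, (2.12) p.256, (2.16) p.257] -/
theorem isMinimizer_ukBox_of_solvable
    (hsolv : ∃ U₀, IsMinimizer (avOfRecord F N K) {U | PlaqSmall (ε * (F.P K).eta k ^ 2) U} (Bj M₁ box4 k)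
      (avgFamily (avOfRecord F N K) (qsstarGIter0 k V)) U₀) :
    IsMinimizer (avOfRecord F N K) {U | PlaqSmall (ε * (F.P K).eta k ^ 2) U} (Bj M₁ box4 k)
      (avgFamily (avOfRecord F N K) (qsstarGIter0 k V))
      (ukBox (bgOfRecord (avOfRecord F N K) {U | PlaqSmall (ε * (F.P K).eta k ^ 2) U}) M₁ box4 k V) :=
  isMinimizer_ukBox (bgOfRecord (avOfRecord F N K) {U | PlaqSmall (ε * (F.P K).eta k ^ 2) U}) M₁
    (box4 := box4) (k := k) (Vk := V) hsolv

/-- **ON THE SOLVABLE SET THE LOCAL BACKGROUND IS REGULAR ON THE WHOLE FINE TORUS**: `|U_{k,□}(V)(∂p) − 1| < ε·η_k²` for every plaquette of `T_η`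
(its membership in the regularity class of the (2.12) problem). [cite: Balaban1988Convergent, (2.12) p.256] -/
theorem plaqSmall_ukBox_of_solvable
    (hsolv : ∃ U₀, IsMinimizer (avOfRecord F N K) {U | PlaqSmall (ε * (F.P K).eta k ^ 2) U} (Bj M₁ box4 k)
      (avgFamily (avOfRecord F N K) (qsstarGIter0 k V)) U₀) :
    PlaqSmall (ε * (F.P K).eta k ^ 2) (ukBox (bgOfRecord (avOfRecord F N K) {U | PlaqSmall (ε * (F.P K).eta k ^ 2) U}) M₁ box4 k V) :=
  (isMinimizer_ukBox_of_solvable hsolv).1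

/-- **THE CONSTRAINT AT THE TOP SCALE** ([Balaban1988Convergent] p. 267 l. 5–7 «M^{k+1}(U_{k+1,□′}) = V_{k+1} on □′~ by the constraints», at the
objects of record): on the solvable set, `M^k(U_{k,□}(V))(b) = V(b)` for every bond `b` of `T^{(k)}` meeting the top-scale member
`Γ_k = pts k (maxDomT M₁ □^{∼4} k)` of `𝐁_k(□^{∼4})` (`Bj_top`), by §1. [cite: Balaban1988Convergent, p.267; Balaban1988Convergent, (2.13) p.257] -/
theorem iter_ukBox_eq_of_mem_bondsOf (hk : k ≤ (F.P K).m + (F.P K).K)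
    (hsolv : ∃ U₀, IsMinimizer (avOfRecord F N K) {U | PlaqSmall (ε * (F.P K).eta k ^ 2) U} (Bj M₁ box4 k)
      (avgFamily (avOfRecord F N K) (qsstarGIter0 k V)) U₀)
    {b : PBond (F.P K) k} (hb : b ∈ bondsOf (pts k (maxDomT M₁ box4 k))) :
    Averaging.iter (avOfRecord F N K) k
        (ukBox (bgOfRecord (avOfRecord F N K) {U | PlaqSmall (ε * (F.P K).eta k ^ 2) U}) M₁ box4 k V) b = V b := by
  have hagree := (isMinimizer_ukBox_of_solvable hsolv).2.1 k b (by rwa [Bj_top])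
  rw [avgFamily_avOfRecord_qsstarGIter0 hk V] at hagree
  exact hagree

/-- The plaquette variable of `V` at a plaquette CORNERED in the top-scale constraint region (`p₋`, `p₋ + e_μ`, `p₋ + e_ν` in
`pts k (maxDomT M₁ □^{∼4} k)`: its four bonds meet the region) is the plaquette variable of `M^k(U_{k,□}(V))` (solvable set).
[cite: Balaban1988Convergent, p.267; Balaban1985Averaging, (9) p.19] -/
theorem plaqHol_eq_plaqHol_iter_ukBox (hk : k ≤ (F.P K).m + (F.P K).K)
    (hsolv : ∃ U₀, IsMinimizer (avOfRecord F N K) {U | PlaqSmall (ε * (F.P K).eta k ^ 2) U} (Bj M₁ box4 k)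
      (avgFamily (avOfRecord F N K) (qsstarGIter0 k V)) U₀)
    (p : Plaq (F.P K) k) (h₀ : p.src ∈ pts k (maxDomT M₁ box4 k)) (hμ : p.src.shift p.μ ∈ pts k (maxDomT M₁ box4 k))
    (hν : p.src.shift p.ν ∈ pts k (maxDomT M₁ box4 k)) :
    GaugeField.plaqHol V p =
      GaugeField.plaqHol (Averaging.iter (avOfRecord F N K) k
        (ukBox (bgOfRecord (avOfRecord F N K) {U | PlaqSmall (ε * (F.P K).eta k ^ 2) U}) M₁ box4 k V)) p := by
  simp only [GaugeField.plaqHol]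
  rw [iter_ukBox_eq_of_mem_bondsOf hk hsolv (b := ⟨p.src, p.μ⟩) (Or.inl h₀),
    iter_ukBox_eq_of_mem_bondsOf hk hsolv (b := ⟨p.src.shift p.μ, p.ν⟩) (Or.inl hμ),
    iter_ukBox_eq_of_mem_bondsOf hk hsolv (b := ⟨p.src.shift p.ν, p.μ⟩) (Or.inl hν),
    iter_ukBox_eq_of_mem_bondsOf hk hsolv (b := ⟨p.src, p.ν⟩) (Or.inl h₀)]

/-- **THE (2.16) PROBLEM OF RECORD IS SOLVABLE ONLY AT LOCALLY REGULAR DATA.**  If the local problem on `□^{∼4}` with regularity threshold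
`ε·η_k²` (`0 < ε`, `C₀(d)ε ≤ ⅓`, `2ε ≤ c′₂ = 2δ_N/((d+4)L)²`, `k ≤ m + K`) is solvable at `V`, then `|V(∂p′) − 1| < 2ε` for every plaquette `p′`
of `T^{(k)}` cornered in `pts k (maxDomT M₁ □^{∼4} k)`: the minimiser is `εη_k²`-regular on the whole fine torus, so its `k`-fold average of
record is `2ε`-regular everywhere ([Balaban1985Averaging] Prop. 2 (52) ⇒ (54), `BlockAveragingEMLProp2.plaqSmall_iter_blockAvg_eml_eta`), and that
average IS `V` on the constraint region (p. 267).  LOCAL twin of n21-c's `plaqSmall_datum_of_ukExists`. [cite: Balaban1985Averaging, Prop. 2 (52)–(54) p.26; Balaban1988Convergent, p.267] -/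
theorem dist1_plaqHol_lt_of_solvable (hk : k ≤ (F.P K).m + (F.P K).K) (hε : 0 < ε)
    (hε3 : (143 * (((((F.P K).d + 4 : ℕ) : ℝ)) ^ 2 / 4) ^ 2) * ε ≤ 1 / 3)
    (hε2 : 2 * ε ≤ 2 * deltaSU (Fin N) / ((((F.P K).d + 4) * (F.P K).L : ℕ) : ℝ) ^ 2)
    (hsolv : ∃ U₀, IsMinimizer (avOfRecord F N K) {U | PlaqSmall (ε * (F.P K).eta k ^ 2) U} (Bj M₁ box4 k)
      (avgFamily (avOfRecord F N K) (qsstarGIter0 k V)) U₀)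
    (p : Plaq (F.P K) k) (h₀ : p.src ∈ pts k (maxDomT M₁ box4 k)) (hμ : p.src.shift p.μ ∈ pts k (maxDomT M₁ box4 k))
    (hν : p.src.shift p.ν ∈ pts k (maxDomT M₁ box4 k)) :
    dist1 (GaugeField.plaqHol V p) < 2 * ε := by
  haveI : Nonempty (Fin N) := ⟨⟨0, Nat.pos_of_ne_zero (NeZero.ne N)⟩⟩
  rw [plaqHol_eq_plaqHol_iter_ukBox hk hsolv p h₀ hμ hν]
  exact BlockAveragingEMLProp2.plaqSmall_iter_blockAvg_eml_eta (P := F.P K) (n := Fin N) k hε hε3 hε2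
    (plaqSmall_ukBox_of_solvable hsolv) p

/-- The set form: on the solvable set, `V` is `2ε`-plaquette-small ON the plaquettes cornered in the top-scale constraint region of `□^{∼4}`.
[cite: Balaban1985Averaging, Prop. 2 (54) p.26; Balaban1988Convergent, p.267] -/
theorem plaqSmallOn_of_solvable (hk : k ≤ (F.P K).m + (F.P K).K) (hε : 0 < ε)
    (hε3 : (143 * (((((F.P K).d + 4 : ℕ) : ℝ)) ^ 2 / 4) ^ 2) * ε ≤ 1 / 3)
    (hε2 : 2 * ε ≤ 2 * deltaSU (Fin N) / ((((F.P K).d + 4) * (F.P K).L : ℕ) : ℝ) ^ 2)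
    (hsolv : ∃ U₀, IsMinimizer (avOfRecord F N K) {U | PlaqSmall (ε * (F.P K).eta k ^ 2) U} (Bj M₁ box4 k)
      (avgFamily (avOfRecord F N K) (qsstarGIter0 k V)) U₀) :
    PlaqSmallOn {p : Plaq (F.P K) k | p.src ∈ pts k (maxDomT M₁ box4 k) ∧ p.src.shift p.μ ∈ pts k (maxDomT M₁ box4 k) ∧
        p.src.shift p.ν ∈ pts k (maxDomT M₁ box4 k)} (2 * ε) V :=
  fun p hp => dist1_plaqHol_lt_of_solvable hk hε hε3 hε2 hsolv p hp.1 hp.2.1 hp.2.2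

end Solvable

/-! ## §3 The semantics of `χ_k(□)`: junk off the solvable set, the minimiser's smallness on it -/

section Chi

variable {K k : ℕ} {ε : ℝ} {M₁ : ℕ} {box4 : Set (Site (F.P K) 0)} {V : GaugeField (F.P K) k (SU N)}

/-- **OFF THE SOLVABLE SET THE LOCAL BACKGROUND OF RECORD IS THE UNIT CONFIGURATION** (the documented junk branch of `Node00.UminOfRecord`).
[cite: Balaban1988Convergent, (2.12) p.256 (typing convention)] -/
theorem ukBox_eq_one_of_not_solvable
    (h : ¬ ∃ U₀, IsMinimizer (avOfRecord F N K) {U | PlaqSmall (ε * (F.P K).eta k ^ 2) U} (Bj M₁ box4 k)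
      (avgFamily (avOfRecord F N K) (qsstarGIter0 k V)) U₀) :
    ukBox (bgOfRecord (avOfRecord F N K) {U | PlaqSmall (ε * (F.P K).eta k ^ 2) U}) M₁ box4 k V = fun _ => 1 :=
  UminOfRecord_of_not _ _ h

/-- The unit configuration has unit plaquette variables. [cite: Balaban1985Averaging, (9) p.19] -/
theorem plaqHol_const_one {P : Params} {j : ℕ} {G : Type*} [GaugeGroup G] (p : Plaq P j) :
    GaugeField.plaqHol (fun _ : PBond P j => (1 : G)) p = 1 := by
  simp [GaugeField.plaqHol]

/-- **`χ_k(□) = 1` BY JUNK OFF THE SOLVABLE SET**: for every plaquette family `S` and every POSITIVE threshold `δ`, the small-field factor of the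
local background of record is `1` when the (2.16) problem is NOT solvable at `V` — the factor then carries no information on `V`
(LOCATED reading of the typing convention; in print the problem is solvable on the inductive small-field domains, [Balaban1985PropagatorsII] Thm 1).
[cite: Balaban1988Convergent, (2.17) p.257 (typing convention)] -/
theorem chiSmall_ukBox_eq_one_of_not_solvable (S : Set (Plaq (F.P K) 0)) {δ : ℝ} (hδ : 0 < δ)
    (h : ¬ ∃ U₀, IsMinimizer (avOfRecord F N K) {U | PlaqSmall (ε * (F.P K).eta k ^ 2) U} (Bj M₁ box4 k)
      (avgFamily (avOfRecord F N K) (qsstarGIter0 k V)) U₀) :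
    chiSmall S δ (ukBox (bgOfRecord (avOfRecord F N K) {U | PlaqSmall (ε * (F.P K).eta k ^ 2) U}) M₁ box4 k V) = 1 := by
  rw [ukBox_eq_one_of_not_solvable h]
  unfold chiSmall
  rw [if_pos]
  intro p _
  rw [plaqHol_const_one, GaugeGroup.dist1_one]
  exact hδ

/-- A NON-ZERO PRODUCT OF SMALL-FIELD FACTORS HAS EVERY FACTOR `1`: for r11's (2.17) `chi217` over ANY solution datum `bg`, `χ_k(Ω_k)(V) ≠ 0` iff
`= 1` iff every cube's factor is `1`, i.e. every local background `U_{k,□}(V)` is `ε_kη_k²`-small on `{p ⊂ □^∼}` (`chi217_eq_one_iff`).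
[cite: Balaban1988Convergent, (2.17) p.257] -/
theorem chi217_eq_one_of_ne_zero {P : Params} {G : Type*} [GaugeGroup G] {av : ∀ j, Averaging P j G} (bg : DetBackground P G av) (M₁ : ℕ)
    {ι : Type*} (X : Finset ι) (plaqT : ι → Set (Plaq P 0)) (enl4 : ι → Set (Site P 0)) (εk : ℝ) (k : ℕ) (Vk : GaugeField P k G)
    (h : chi217 bg M₁ X plaqT enl4 εk k Vk ≠ 0) : chi217 bg M₁ X plaqT enl4 εk k Vk = 1 := by
  rw [chi217_apply] at h ⊢
  refine Finset.prod_eq_one fun c hc => ?_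
  have hc0 : chiSmall (plaqT c) (εk * P.eta k ^ 2) (ukBox bg M₁ (enl4 c) k Vk) ≠ 0 := fun h0 => h (Finset.prod_eq_zero hc h0)
  by_cases hs : PlaqSmallOn (plaqT c) (εk * P.eta k ^ 2) (ukBox bg M₁ (enl4 c) k Vk)
  · simp [chiSmall, hs]
  · exact absurd (by simp [chiSmall, hs]) hc0

/-- ON ITS SUPPORT `χ_k(Ω_k)` PINS EVERY LOCAL BACKGROUND SMALL: `chi217 … V ≠ 0 ⇒` for every cube `□ ∈ X`, `|U_{k,□}(V)(∂p) − 1| < ε_kη_k²` on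
`{p ⊂ □^∼}` (literal semantics; informative only on the solvable set, §2 ∕ `chiSmall_ukBox_eq_one_of_not_solvable`). [cite: Balaban1988Convergent, (2.17) p.257] -/
theorem plaqSmallOn_ukBox_of_chi217_ne_zero {P : Params} {G : Type*} [GaugeGroup G] {av : ∀ j, Averaging P j G} (bg : DetBackground P G av)
    (M₁ : ℕ) {ι : Type*} (X : Finset ι) (plaqT : ι → Set (Plaq P 0)) (enl4 : ι → Set (Site P 0)) (εk : ℝ) (k : ℕ) (Vk : GaugeField P k G)
    (h : chi217 bg M₁ X plaqT enl4 εk k Vk ≠ 0) :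
    ∀ c ∈ X, PlaqSmallOn (plaqT c) (εk * P.eta k ^ 2) (ukBox bg M₁ (enl4 c) k Vk) :=
  (chi217_eq_one_iff bg M₁ X plaqT enl4 εk k Vk).1 (chi217_eq_one_of_ne_zero bg M₁ X plaqT enl4 εk k Vk h)

/-- **THE LITERAL SEMANTICS OF def-R's `chiSeqOfRecord`**: wherever `χ_k(Ω_k(s))(V) ≠ 0`, for every `LM₂R_k`-cube `□ ⊂ Ω_k(s)` of the step-`k` partition
the local background of record `U_{k,□}(V)` (regularity threshold `εreg·η_k²`, determining-set width `M₁`, domain `□^{∼4}`) is `ε_k η_k²`-small on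
the plaquettes inside `□^∼`, `ε_k = epsOfRecord ν g k` — by junk (§3) or by a genuine minimiser (solvable set, where §2 gives the smallness OF `V`).
[cite: Balaban1988Convergent, (2.17)–(2.18) p.257] -/
theorem plaqSmallOn_ukBox_of_chiSeqOfRecord_ne_zero (ν : Stage7Numerics) (M : ℕ) (g : ℕ → ℝ) (K k : ℕ) (s : SeqOfRecord F ν M g K k)
    (V : GaugeField (F.P K) k (SU N)) (h : chiSeqOfRecord F N ν M g K k s V ≠ 0) :
    ∀ a ∈ cubesIn (fun a : ↥(cubeIndices (F.P K) (cubeSide (F.P K).L ν.M₂ (RkOfRecord (F.P K).L ν.r (g k)) k)) =>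
        cubeEnl (F.P K) (cubeSide (F.P K).L ν.M₂ (RkOfRecord (F.P K).L ν.r (g k)) k) a 0) (s.Ω k),
      PlaqSmallOn (plaqInside (cubeEnl (F.P K) (cubeSide (F.P K).L ν.M₂ (RkOfRecord (F.P K).L ν.r (g k)) k) a 1))
        (epsOfRecord ν g k * (F.P K).eta k ^ 2)
        (ukBox (bgOfRecord (avOfRecord F N K) {U | PlaqSmall (ν.εreg * (F.P K).eta k ^ 2) U}) ν.M₁
          (cubeEnl (F.P K) (cubeSide (F.P K).L ν.M₂ (RkOfRecord (F.P K).L ν.r (g k)) k) a 4) k V) := by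
  unfold chiSeqOfRecord chi218 at h
  exact plaqSmallOn_ukBox_of_chi217_ne_zero _ _ _ _ _ _ _ _ h

/-- The same for `χ_k(T_η)` of record (`Node00.chiOfRecord`, all cubes of the partition). [cite: Balaban1988Convergent, (2.17) p.257] -/
theorem plaqSmallOn_ukBox_of_chiOfRecord_ne_zero (ν : Stage7Numerics) (g : ℕ → ℝ) (K k : ℕ) (V : GaugeField (F.P K) k (SU N))
    (h : chiOfRecord F N ν g K k V ≠ 0) :
    ∀ a ∈ cubeIndices (F.P K) (cubeSide (F.P K).L ν.M₂ (RkOfRecord (F.P K).L ν.r (g k)) k),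
      PlaqSmallOn (plaqInside (cubeEnl (F.P K) (cubeSide (F.P K).L ν.M₂ (RkOfRecord (F.P K).L ν.r (g k)) k) a 1))
        (epsOfRecord ν g k * (F.P K).eta k ^ 2)
        (ukBox (bgOfRecord (avOfRecord F N K) {U | PlaqSmall (ν.εreg * (F.P K).eta k ^ 2) U}) ν.M₁
          (cubeEnl (F.P K) (cubeSide (F.P K).L ν.M₂ (RkOfRecord (F.P K).L ν.r (g k)) k) a 4) k V) := by
  rw [chiOfRecord_eq_chi217] at h
  exact plaqSmallOn_ukBox_of_chi217_ne_zero _ _ _ _ _ _ _ _ h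

end Chi


/-! ## §4 Module 4's smallness-on-support hypothesis from solvability on the support -/

section Junction

variable (F : T4Family) (N : ℕ) [NeZero N] (ν : Stage7Numerics) (Mν : ℕ) (w : StepWeightsOfRecord F N ν Mν)
  (p : B12.RunParams) (g : ℕ → ℝ) (k : ℕ)

/-- **«LCS-(k+1)» BY VALUE AT THE RECORD, WITH `hsupp` DISCHARGED FROM SOLVABILITY ON THE SUPPORT.**  Generation 3's
`N20LCSAvgByValue.lcs_piece_tstepOfRecord_expPlaqSum_byValue` (its provisos verbatim: performed level `k < K`, integrable old piece, bounded
jointly measurable step weight, measurable new front factor, non-negative pinned fine density, `Q` a finite set of level-`(k+1)` plaquettes,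
`t ≥ 0`) at `δ = 2ε`, where `ε` is the regularity threshold of the local problems (`0 < ε`, `C₀(d)ε ≤ ⅓`, `2ε ≤ c′₂`, guard
`(((d+2)L)²/4)·2ε < δ_N`), GIVEN: a family of domains `boxes i` (print: the enlarged cubes `□^{∼4}` of the step-`k` partition inside `Ω_k`) whose
top-scale constraint regions `pts k (maxDomT M₁ (boxes i) k)` corner every level-`k` plaquette of the boxes `boxRegion (emb p′₋) ((d+3)L+2)`,
`p′ ∈ Q` (`hcover`), and SOLVABILITY of the (2.16) problems of record on every `boxes i` wherever the pinned fine density is non-zero (`hsolv`,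
the (H-U)-shaped hypothesis).  Conclusion: the `LocCondStability` inequality of the piece for `M = exp(t·Σ_{p′∈Q}(1 − reTr V(∂p′)))` with
`b = t·(C_L·2ε)²·#Q`, `C_L = L² + 6((d+2)L)²`. [cite: Balaban1989LargeFieldII, p.383; Balaban1988Convergent, p.267; Balaban1985Averaging, Prop. 2 (54) p.26] -/
theorem lcs_piece_tstepOfRecord_expPlaqSum_bySolvability (hk : k < p.K)
    (T : SeqOfRecord F ν Mν g p.K k → Density (F.P p.K) k (SU N)) (s' : SeqOfRecord F ν Mν g p.K (k + 1))
    (hT : Integrable (fun U => chiSeqOfRecord F N ν Mν g p.K k s'.init U * T s'.init U) (fieldMeasure (F.P p.K) k (SU N)))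
    (hw : Measurable
      (fun z : GaugeField (F.P p.K) (k + 1) (SU N) × GaugeField (F.P p.K) k (SU N) => w p g k s' z.2 z.1))
    (hwb : ∀ U V', |w p g k s' U V'| ≤ 1) (hχ : Measurable (chiSeqOfRecord F N ν Mν g p.K (k + 1) s'))
    (h0 : ∀ U, 0 ≤ (chiSeqOfRecord F N ν Mν g p.K (k + 1) s' ((avOfRecord F N p.K k).avg U) *
        w p g k s' U ((avOfRecord F N p.K k).avg U)) * (chiSeqOfRecord F N ν Mν g p.K k s'.init U * T s'.init U))
    (Q : Finset (Plaq (F.P p.K) (k + 1))) {t : ℝ} (ht0 : 0 ≤ t) {ε : ℝ} (hε : 0 < ε)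
    (hε3 : (143 * (((((F.P p.K).d + 4 : ℕ) : ℝ)) ^ 2 / 4) ^ 2) * ε ≤ 1 / 3)
    (hε2 : 2 * ε ≤ 2 * deltaSU (Fin N) / ((((F.P p.K).d + 4) * (F.P p.K).L : ℕ) : ℝ) ^ 2)
    (hguard : (((((F.P p.K).d + 2) * (F.P p.K).L : ℕ) : ℝ) ^ 2 / 4) * (2 * ε) < deltaSU (Fin N))
    (M₁ : ℕ) {ι : Type*} (boxes : ι → Set (Site (F.P p.K) 0))
    (hcover : ∀ p' ∈ Q, ∀ q ∈ boxRegion (emb p'.src) (((F.P p.K).d + 3) * (F.P p.K).L + 2), ∃ i,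
      q.src ∈ pts k (maxDomT M₁ (boxes i) k) ∧ q.src.shift q.μ ∈ pts k (maxDomT M₁ (boxes i) k) ∧
        q.src.shift q.ν ∈ pts k (maxDomT M₁ (boxes i) k))
    (hsolv : ∀ U, (chiSeqOfRecord F N ν Mν g p.K (k + 1) s' ((avOfRecord F N p.K k).avg U) *
        w p g k s' U ((avOfRecord F N p.K k).avg U)) * (chiSeqOfRecord F N ν Mν g p.K k s'.init U * T s'.init U) ≠ 0 →
        ∀ i, ∃ U₀, IsMinimizer (avOfRecord F N p.K) {W | PlaqSmall (ε * (F.P p.K).eta k ^ 2) W} (Bj M₁ (boxes i) k)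
          (avgFamily (avOfRecord F N p.K) (qsstarGIter0 k U)) U₀) :
    ∫ V', Real.exp (t * ∑ p' ∈ Q, (1 - reTr (GaugeField.plaqHol V' p'))) *
          (chiSeqOfRecord F N ν Mν g p.K (k + 1) s' V' * tstepOfRecord F N ν Mν w p g k T s' V')
        ∂(fieldMeasure (F.P p.K) (k + 1) (SU N)) ≤
      Real.exp (t * (((((F.P p.K).L : ℝ) ^ 2 + 6 * ((((F.P p.K).d + 2) * (F.P p.K).L : ℕ) : ℝ) ^ 2) * (2 * ε)) ^ 2 * Q.card)) *
        ∫ V', chiSeqOfRecord F N ν Mν g p.K (k + 1) s' V' * tstepOfRecord F N ν Mν w p g k T s' V'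
          ∂(fieldMeasure (F.P p.K) (k + 1) (SU N)) := by
  have hkm : k ≤ (F.P p.K).m + (F.P p.K).K := by
    rw [T4Family.P_K, T4Family.P_m]; omega
  refine lcs_piece_tstepOfRecord_expPlaqSum_byValue F N ν Mν w p g k hk T s' hT hw hwb hχ h0 Q ht0 (by positivity) hguard
    fun U hU p' hp' q hq => ?_
  obtain ⟨i, h₁, h₂, h₃⟩ := hcover p' hp' q hq
  exact (dist1_plaqHol_lt_of_solvable hkm hε hε3 hε2 (hsolv U hU i) q h₁ h₂ h₃).le

end Junction

end Summit.QuantumFields.YangMills.BalabanUVNodes.N20ChiSemantics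

end
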